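import Literature.AnabelianGeometry.EtaleTheta.Discharge.Sec2DtpYThetaAbelianCorollaries
import Literature.AnabelianGeometry.EtaleTheta.Discharge.Sec2Prop214iiOfOrigin
import Literature.AnabelianGeometry.EtaleTheta.SettingModelChiThetaDoubleUnderline
import HarnessLib

/-!
# [EtTh] Prop 2.12 (i)(ii), Prop 2.14 (i)(ii), Cor 2.18 (ii), Cor 2.18 (iv) (fibres) for the §1 → §2
# rigidity data AT THE RECORD MODEL `ThetaSetting.modelχ p`: the guard `IsEtThOrigin` and the binder `hYcl`
# are THEOREMS there (proof-only capstone; FROZEN FACT-LIST rows F-0631, F-0632, F-1920, F-0630, F-0624, F-0621)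

Mochizuki, *The étale theta function and its Frobenioid-theoretic manifestations*, Publ. RIMS **45**
(2009) [EtTh], §2: Prop. 2.12 (i)(ii) PRIMS PDF p. 45, Prop. 2.14 (i)(ii) p. 49, Cor. 2.18 (ii) p. 60,
Cor. 2.18 (iv) p. 61 [cite: MochizukiEtTh2009, Prop 2.14 (i) p.49].  Cell `abc-iut`, block F, seat
abc-iut-f-149 (gen 2; F-TRANCHES tranche 149 = F-0631/F-0632/F-0633/F-0634 of D-0078 (S1)).  PROOF-ONLY:
no definition, no instance, nothing of another seat edited or restated.

STATE OF RECORD.  Over the lawless interface `RigidData N l` (`ThetaRigidity.lean`) the universal closures of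
these rows are REFUTED at explicit toys (abc-iut-w5-d175: `RigidData.Toy.not_forall_prop214_i`,
`RigidData.ToyTw.not_forall_prop214_ii`, …), so the rows are consumable AT A NAMED INSTANCE only (R5).  The
named instance the cone consumes is abc-iut-L2-t8's §1 → §2 adapter `C.rigidData μ hC hS h15 L`
(`RigidOfSetting.lean`) over a theta setting `D`, an étale-theta datum `E`, a choice `X̲̲` (`C`), a level-`N`
cyclotome identification `μ` and cusp labels `L`; there the rows are PROVED (abc-iut-L5-t14 / abc-iut-L2-t8 /
abc-iut-L2-t10: `rigidData_prop214_i_of_origin`, `rigidData_prop212_i/_ii_of_origin`,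
`rigidData_cor218_iv_fibre_of_origin`, `rigidData_prop214_ii_of_origin`, `rigidData_cor218_ii_of_origin`)
modulo exactly the guard `hO : D.IsEtThOrigin` ("`Δ_X` is the profinite completion of a free group",
[EtTh] §1 p. 12) and — for (2.12)/(2.14 (i))/(2.18 (iv)) — the binder `hYcl` ("(Δ^tp_Y)^Θ is profinite",
pp. 12–13), resp. — for (2.14 (ii))/(2.18 (ii)) — the named §1 fact `Prop15ii` (F-2503).

THIS FILE.  At the record model `ThetaSetting.modelχ p` of the R78 cluster (abc-iut-L2-t1's
`SettingModelChiTheta.lean`: non-trivial Galois action `χ` on `Δ_Θ ≅ Ẑ(1)`) BOTH residual binders are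
THEOREMS — `ThetaSetting.modelχ_isEtThOrigin` and `SettingModel.hYcl_modelχ` — so for EVERY étale-theta datum
`E` over `modelχ p`, every `X̲̲`-choice `C : E.DoubleUnderline l`, every level `μ`, every `hC`/`hS`/`h15` and
every labelling `L`:

* `rigidData_prop214_i_modelχ`   — F-0631 `RigidData.Prop214_i` HOLDS at the χ-model's rigidity data;
* `rigidData_prop212_i_modelχ`, `rigidData_prop212_ii_modelχ` — F-1920 / F-0630 likewise;
* `rigidData_cor218_iv_fibre_modelχ` — F-0624 likewise;
* `rigidData_prop214_ii_modelχ`, `rigidData_cor218_ii_modelχ` — F-0632 / F-0621 modulo `Prop15ii` ONLY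
  (the guard of abc-iut-L2-t8's `…_of_origin` forms discharged; `Prop15iii` is an input of `rigidData`).

The remaining binders are the construction's DATA inputs (`E`, `C`, `μ`, `hC`, `hS`, `h15`, `L`; at `modelχ`
`hS` is itself a theorem, `ThetaSetting.modelχ_sec2Hyps`, but is kept as a binder so the statements match
any consumer's term).  HONEST LABEL: `modelχ` is a SEMI-SYNTHETIC model of the typed §1 interface —
consistency / non-vacuity evidence for the binder set {`IsEtThOrigin`, `hYcl`} of the lane-C2 discharges,
not the tempered `π₁` of a curve; nothing of [EtTh] (refereed) is asserted; no side is taken on [IUTchIII]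
Cor. 3.12; typed ≠ proved; a FACT row is an assumption label, not an endorsement.
-/

noncomputable section

namespace Literature.AnabelianGeometry.EtaleTheta.SettingModel

open Literature.AnabelianGeometry.SemiGraphs

variable (p : ℕ) [Fact p.Prime]
variable {E : (ThetaSetting.modelχ p).EtaleThetaData} {l : ℕ} (C : E.DoubleUnderline l) {N : ℕ+}
  (μ : (ThetaSetting.modelχ p).CyclotomeMod l N)

/-! ## Prop 2.14 (i), Prop 2.12 (i)(ii), Cor 2.18 (iv) fibres — unconditional in the guard and `hYcl` -/

/-- **F-0631 `RigidData.Prop214_i` at the χ-model's rigidity data** ([EtTh] Prop. 2.14 (i), p. 49: "the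
subset `{γ(β)·β⁻¹}` … coincides with the image of the tautological section of `(l·Δ_Θ)[μ_N] ↠ (l·Δ_Θ)`"):
for every étale-theta datum over `modelχ p`, every `X̲̲`, level and labelling — abc-iut-L2-t8's
`rigidData_prop214_i_of_origin` with `IsEtThOrigin`, `hYcl` supplied by `modelχ_isEtThOrigin`, `hYcl_modelχ`.
[cite: MochizukiEtTh2009, Prop 2.14 (i) p.49] -/
theorem rigidData_prop214_i_modelχ (hC : (ThetaSetting.modelχ p).Compat)
    (hS : (ThetaSetting.modelχ p).Sec2Hyps) (h15 : ThetaSetting.Prop15iii E hC) (L : C.CuspLabels) :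
    Literature.AnabelianGeometry.EtaleTheta.RigidData.Prop214_i (C.rigidData μ hC hS h15 L) :=
  C.rigidData_prop214_i_of_origin μ hC hS h15 L (ThetaSetting.modelχ_isEtThOrigin p) (hYcl_modelχ p)

/-- **F-1920 `RigidData.Prop212_i` at the χ-model's rigidity data** ([EtTh] Prop. 2.12 (i), p. 45:
"`l·Δ_Θ ⊆ [Δ^Θ_*, Δ^Θ_*]`"). [cite: MochizukiEtTh2009, Prop 2.12 (i) p.45] -/
theorem rigidData_prop212_i_modelχ (hC : (ThetaSetting.modelχ p).Compat)
    (hS : (ThetaSetting.modelχ p).Sec2Hyps) (h15 : ThetaSetting.Prop15iii E hC) (L : C.CuspLabels) :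
    Literature.AnabelianGeometry.EtaleTheta.RigidData.Prop212_i (C.rigidData μ hC hS h15 L) :=
  C.rigidData_prop212_i_of_origin μ hC hS h15 L (ThetaSetting.modelχ_isEtThOrigin p) (hYcl_modelχ p)

/-- **F-0630 `RigidData.Prop212_ii` at the χ-model's rigidity data** ([EtTh] Prop. 2.12 (ii), p. 45:
"follows formally from (i)"). [cite: MochizukiEtTh2009, Prop 2.12 (ii) p.45] -/
theorem rigidData_prop212_ii_modelχ (hC : (ThetaSetting.modelχ p).Compat)
    (hS : (ThetaSetting.modelχ p).Sec2Hyps) (h15 : ThetaSetting.Prop15iii E hC) (L : C.CuspLabels) :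
    Literature.AnabelianGeometry.EtaleTheta.RigidData.Prop212_ii (C.rigidData μ hC hS h15 L) :=
  C.rigidData_prop212_ii_of_origin μ hC hS h15 L (ThetaSetting.modelχ_isEtThOrigin p) (hYcl_modelχ p)

/-- **F-0624 `RigidData.Cor218_iv_fibre` at the χ-model's rigidity data** ([EtTh] Cor. 2.18 (iv), p. 61:
the fibres of "liftings ↦ induced automorphism" are the printed twists, via Prop. 2.14 (i)).
[cite: MochizukiEtTh2009, Cor 2.18 (iv) p.61] -/
theorem rigidData_cor218_iv_fibre_modelχ (hC : (ThetaSetting.modelχ p).Compat)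
    (hS : (ThetaSetting.modelχ p).Sec2Hyps) (h15 : ThetaSetting.Prop15iii E hC) (L : C.CuspLabels) :
    Literature.AnabelianGeometry.EtaleTheta.RigidData.Cor218_iv_fibre (C.rigidData μ hC hS h15 L) :=
  C.rigidData_cor218_iv_fibre_of_origin μ hC hS h15 L (ThetaSetting.modelχ_isEtThOrigin p) (hYcl_modelχ p)

/-! ## Prop 2.14 (ii), Cor 2.18 (ii) — modulo Prop 1.5 (ii) (F-2503) only -/

/-- **F-0632 `RigidData.Prop214_ii` at the χ-model's rigidity data, modulo Prop. 1.5 (ii) only** ([EtTh]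
Prop. 2.14 (ii), p. 49: "`δ` extends to a cocycle of `Π^tp_Y` … `α_δ` preserves `D_Y`"; printed dependency
"cf. Proposition 1.5, (ii), (iii)") — abc-iut-L2-t8's `rigidData_prop214_ii_of_origin` with the guard
supplied by `modelχ_isEtThOrigin`. [cite: MochizukiEtTh2009, Prop 2.14 (ii) p.49] -/
theorem rigidData_prop214_ii_modelχ (hC : (ThetaSetting.modelχ p).Compat)
    (hS : (ThetaSetting.modelχ p).Sec2Hyps) (h15 : ThetaSetting.Prop15iii E hC)
    (h15ii : ThetaSetting.Prop15ii E.toKummerData hC) (L : C.CuspLabels) :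
    Literature.AnabelianGeometry.EtaleTheta.RigidData.Prop214_ii (C.rigidData μ hC hS h15 L) :=
  C.rigidData_prop214_ii_of_origin μ hC hS h15 h15ii L (ThetaSetting.modelχ_isEtThOrigin p)

/-- **F-0621 `RigidData.Cor218_ii` at the χ-model's rigidity data, modulo Prop. 1.5 (ii) only** ([EtTh]
Cor. 2.18 (ii), p. 60: "precisely the content of Prop. 2.14 (ii)").
[cite: MochizukiEtTh2009, Cor 2.18 (ii) p.60] -/
theorem rigidData_cor218_ii_modelχ (hC : (ThetaSetting.modelχ p).Compat)
    (hS : (ThetaSetting.modelχ p).Sec2Hyps) (h15 : ThetaSetting.Prop15iii E hC)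
    (h15ii : ThetaSetting.Prop15ii E.toKummerData hC) (L : C.CuspLabels) :
    Literature.AnabelianGeometry.EtaleTheta.RigidData.Cor218_ii (C.rigidData μ hC hS h15 L) :=
  C.rigidData_cor218_ii_of_origin μ hC hS h15 h15ii L (ThetaSetting.modelχ_isEtThOrigin p)

/-! ## Joint form: the lane-C2 guard rows of [EtTh] §2 at the record model, with `hS` also discharged -/

/-- **The four guard-and-`hYcl` rows together at the χ-model, with `Sec2Hyps` supplied by
`ThetaSetting.modelχ_sec2Hyps`**: for every étale-theta datum `E` over `modelχ p` with `Compat` and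
Prop. 1.5 (iii), every `X̲̲`, level and labelling, Prop. 2.12 (i), (ii), Prop. 2.14 (i) and the fibre clause
of Cor. 2.18 (iv) HOLD for the rigidity data. [cite: MochizukiEtTh2009, Prop 2.14 (i) p.49] -/
theorem rigidData_sec2_guard_rows_modelχ (hC : (ThetaSetting.modelχ p).Compat)
    (h15 : ThetaSetting.Prop15iii E hC) (L : C.CuspLabels) :
    Literature.AnabelianGeometry.EtaleTheta.RigidData.Prop212_i
        (C.rigidData μ hC (ThetaSetting.modelχ_sec2Hyps p) h15 L) ∧
      Literature.AnabelianGeometry.EtaleTheta.RigidData.Prop212_ii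
        (C.rigidData μ hC (ThetaSetting.modelχ_sec2Hyps p) h15 L) ∧
      Literature.AnabelianGeometry.EtaleTheta.RigidData.Prop214_i
        (C.rigidData μ hC (ThetaSetting.modelχ_sec2Hyps p) h15 L) ∧
      Literature.AnabelianGeometry.EtaleTheta.RigidData.Cor218_iv_fibre
        (C.rigidData μ hC (ThetaSetting.modelχ_sec2Hyps p) h15 L) :=
  ⟨rigidData_prop212_i_modelχ p C μ hC _ h15 L, rigidData_prop212_ii_modelχ p C μ hC _ h15 L,
    rigidData_prop214_i_modelχ p C μ hC _ h15 L, rigidData_cor218_iv_fibre_modelχ p C μ hC _ h15 L⟩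

end Literature.AnabelianGeometry.EtaleTheta.SettingModel

end
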